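import Literature.Geometry.GeometricMeasureTheory.BlowUpCycle
import Literature.Geometry.GeometricMeasureTheory.LowerDensityBound
import Literature.Geometry.Kaehler.TangentConeFlat
import HarnessLib

/-!
# Sphere slices of the blow-up limit are rectifiable (under the induction hypothesis)

Support file for the proof of the named fact
`Literature.Geometry.GeometricMeasureTheory.Federer1969_compactness_integralCurrents` along
B. White's structure-theorem-free proof of the closure theorem, Step 5 of [White1989, p. 220]
("`θ(a)` is an integer: … `∂(C ⌞ 𝐁(0, r))` is, for almost every `r`, the limit of the integral
cycles `∂(T_{a,λ_l} ⌞ 𝐁(0, r))` of bounded mass, hence an integral `(n−1)`-current by the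
induction hypothesis"; [Bandara2006, proof of Thm. 4.2.1, p. 45]).

Setting (`BlowUpCycle`): `σ` finite, `ξ ∈ L¹(σ)`, `T = σ ∧ ξ` a cycle, `a` a normalised Lebesgue
point of `ξ` with polynomial growth `‖T‖(𝐁(a, s)) ≤ K s^{k+1}`, `λ_l ↓ 0` with `σ_{a,λ_l} → ν`
vaguely, `ν` charging no sphere about `0`; and, from the slicing theory applied to the approximating
sequence (`LimitSlicesRectifiable`), the ball pieces `T ⌞ 𝐁(a, r)` have rectifiable boundary for
a.e. `r`.

* `Measure.blowUp_restrict_closedBall` — `σ_{a,r} ⌞ 𝐁(0, ρ) = (σ ⌞ 𝐁(a, rρ))_{a,r}`;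
* `boundary_blowUpCurrent_restrict_eq` — the boundary of the ball piece `T_{a,r} ⌞ 𝐁(0, ρ)` of a
  blow-up is the dilation `[A⁻¹W', θ' ∘ A, ξ' ∘ A]` (`A y = a + r y`) of the slice boundary
  `∂(T ⌞ 𝐁(a, rρ)) = [W', θ', ξ']` [Federer1969, 4.1.7, 4.3.16];
* `isRectifiable_boundary_blowUpCurrent_restrict` — hence it is rectifiable, of mass
  `≤ r^{-k} 𝐌(∂(T ⌞ 𝐁(a, rρ)))`;
* `ae_comp_mul_left_of_ae`, `ae_liminf_ofReal_deriv_lt_top` — a.e. bookkeeping along the scales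
  `λ_l ρ`, and the Fatou selection `liminf_l λ_l^{-k} f'(λ_l ρ) < ∞` for a.e. `ρ` for a monotone
  `f` with `f(s) ≤ K s^{k+1}` [White1989, p. 211];
* **`ae_isRectifiable_boundary_blowUpLimit_piece`** — for a.e. `ρ > 0`, the boundary of
  `C ⌞ 𝐁(0, ρ)`, `C = ν ∧ ξ(a)` the cone limit, is rectifiable, GIVEN the induction hypothesis that
  weak limits of rectifiable `k`-dimensional boundaries of bounded mass and support are
  rectifiable (the shape used in `Current.ae_isRectifiable_boundary_piece_of_tendsto`).

## References

* B. White, *A new proof of the compactness theorem for integral currents*, Comment. Math. Helv.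
  64 (1989) 207–220, pp. 211, 220 [White1989].
* L. Bandara, *The closure theorem for integral currents without the structure theorem*,
  B.Sc. thesis, ANU 2006, proof of Thm. 4.2.1, p. 45 (held copy
  `lit paper:galaxy-pdf-8023002039701172160`) [Bandara2006].
* H. Federer, *Geometric Measure Theory*, Springer 1969, 4.1.7, 4.2.1, 4.3.16 [Federer1969].
-/

noncomputable section

open scoped ENNReal NNReal Topology
open MeasureTheory TopologicalSpace Set Filter Metric Function

namespace Literature.Geometry.GeometricMeasureTheory

-- Nested operator-norm instances on (duals of) `E [⋀^Fin m]→L[ℝ] ℝ`, as in `Currents.lean`.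
set_option maxSynthPendingDepth 3

variable {V : Type*} [NormedAddCommGroup V] [InnerProductSpace ℝ V] [FiniteDimensional ℝ V]
  [MeasurableSpace V] [BorelSpace V] {k : ℕ}

/-! ### Ball pieces of blow-ups are blow-ups of ball pieces -/

section Pieces

omit [FiniteDimensional ℝ V] in
/-- `σ_{a,r} ⌞ 𝐁(0, ρ) = (σ ⌞ 𝐁(a, rρ))_{a,r}`. [cite: White1989, p. 216; Federer1969, 4.1.7] -/
theorem Measure.blowUp_restrict_closedBall (σ : Measure V) (m : ℕ) (a : V) {r : ℝ} (hr : 0 < r)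
    (ρ : ℝ) :
    (Measure.blowUp σ m a r).restrict (closedBall 0 ρ) =
      Measure.blowUp (σ.restrict (closedBall a (r * ρ))) m a r := by
  ext s hs
  have hinj : Injective (fun y : V => a + r • y) := (bijective_add_smul a hr.ne').1
  rw [Measure.restrict_apply hs, Measure.blowUp_apply _ _ _ hr, Measure.blowUp_apply _ _ _ hr,
    Measure.restrict_apply' measurableSet_closedBall, image_inter hinj,
    image_add_smul_closedBall a 0 hr ρ, smul_zero, add_zero]

variable {σ : Measure V} {ξ : V → Multivector V (k + 1)}

omit [FiniteDimensional ℝ V] in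
/-- **The boundary of a ball piece of a blow-up is the dilated slice boundary**: if
`∂(T ⌞ 𝐁(a, rρ)) = [W', θ', ξ']` (`T = σ ∧ ξ`), then
`∂(T_{a,r} ⌞ 𝐁(0, ρ)) = [A⁻¹W', θ' ∘ A, ξ' ∘ A]` for the dilation `A y = a + r y`.
[cite: Federer1969, 4.1.7, 4.3.16] -/
theorem boundary_blowUpCurrent_restrict_eq (hξ : Integrable ξ σ) (a : V) {r : ℝ} (hr : 0 < r)
    (ρ : ℝ) {W' : Set V} (hW' : MeasurableSet W') {θ' : V → ℤ} {ξ' : V → Fin k → V}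
    (hint : LocallyIntegrableOn (fun x => (θ' x : ℝ) • frameVector (ξ' x))
      ((⊤ : Opens V) : Set V) ((μHE[k] : Measure V).restrict W'))
    (hZ : (vectorCurrent (σ.restrict (closedBall a (r * ρ))) ξ :
        Current (⊤ : Opens V) (k + 1)).boundary = currentOfIntegration W' θ' ξ') :
    (vectorCurrent ((Measure.blowUp σ (k + 1) a r).restrict (closedBall 0 ρ))
        (fun y => ξ (a + r • y)) : Current (⊤ : Opens V) (k + 1)).boundary =
      currentOfIntegration ((fun y : V => a + r • y) ⁻¹' W' ∩ ((⊤ : Opens V) : Set V))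
        (fun y => θ' (a + r • y)) (fun y => ξ' (a + r • y)) := by
  ext φ
  -- the right-hand side: the push-forward formula
  obtain ⟨ψ', hψ'⟩ := exists_testForm_dilate a hr 1 φ
  have hφψ' : ∀ y, φ y = ψ' (a + r • y) := fun y => by
    rw [hψ', one_smul, add_sub_cancel_left, smul_smul, inv_mul_cancel₀ hr.ne', one_smul]
  rw [currentOfIntegration_preimage_add_smul_apply hW' θ' ξ' a hr (by simp) hint φ ψ' hφψ']
  -- the left-hand side: `T_{a,r} ⌞ 𝐁(0,ρ) = (T ⌞ 𝐁(a, rρ))_{a,r}` tested against `dφ`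
  rw [Current.boundary_apply, Measure.blowUp_restrict_closedBall σ (k + 1) a hr ρ]
  change blowUpCurrent (σ.restrict (closedBall a (r * ρ))) ξ a r (TestForm.extDerivCLM φ) = _
  obtain ⟨χ, hχ⟩ := exists_testForm_dilate a hr ((r⁻¹) ^ k) φ
  have hdχ : ∀ x, TestForm.extDerivCLM χ x =
      ((r⁻¹) ^ (k + 1)) • TestForm.extDerivCLM φ (r⁻¹ • (x - a)) := fun x => by
    rw [extDerivCLM_dilate_apply a r _ φ χ hχ x, ← pow_succ]
  rw [blowUpCurrent_apply_eq hξ.restrict a hr _ _ hdχ, ← Current.boundary_apply, hZ]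
  have hχψ : χ = ((r⁻¹) ^ k) • ψ' := by
    ext x v
    rw [hχ x]
    simp [hψ' x]
  rw [hχψ, map_smul, smul_eq_mul]

/-- The support of the ball piece `T ⌞ 𝐁(a, s)` and of its boundary lie in the ball.
[cite: Federer1969, 4.1.7] -/
theorem support_boundary_vectorCurrent_restrict_subset (hξ : Integrable ξ σ) (a : V) (s : ℝ) :
    (vectorCurrent (σ.restrict (closedBall a s)) ξ : Current (⊤ : Opens V) (k + 1)).boundary.support
      ⊆ closedBall a s := by
  refine (Current.support_boundary_subset _).trans ?_
  have hloc : LocallyIntegrableOn ξ ((⊤ : Opens V) : Set V) σ :=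
    hξ.locallyIntegrable.locallyIntegrableOn _
  rw [← restrictSet_vectorCurrent hloc measurableSet_closedBall]
  exact ((isRepresentable_vectorCurrent hloc).support_restrictSet_subset_closure
    measurableSet_closedBall).trans (by rw [closure_closedBall])

/-- **The boundary of a ball piece of a blow-up is rectifiable when the slice boundary is**, with
`𝐌(∂(T_{a,r} ⌞ 𝐁(0,ρ))) ≤ r^{-k} 𝐌(∂(T ⌞ 𝐁(a, rρ)))` (dilations of admissible data are
admissible, `IsRectifiableData.preimage_add_smul`). [cite: Federer1969, 4.1.7, 4.3.16] -/
theorem isRectifiable_boundary_blowUpCurrent_restrict (hξ : Integrable ξ σ) (a : V) {r : ℝ}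
    (hr : 0 < r) (ρ : ℝ)
    (hZ' : (vectorCurrent (σ.restrict (closedBall a (r * ρ))) ξ :
      Current (⊤ : Opens V) (k + 1)).boundary.IsRectifiable) :
    (vectorCurrent ((Measure.blowUp σ (k + 1) a r).restrict (closedBall 0 ρ))
        (fun y => ξ (a + r • y)) : Current (⊤ : Opens V) (k + 1)).boundary.IsRectifiable ∧
      (vectorCurrent ((Measure.blowUp σ (k + 1) a r).restrict (closedBall 0 ρ))
        (fun y => ξ (a + r • y)) : Current (⊤ : Opens V) (k + 1)).boundary.mass ≤
        ENNReal.ofReal ((r⁻¹) ^ k) *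
          (vectorCurrent (σ.restrict (closedBall a (r * ρ))) ξ :
            Current (⊤ : Opens V) (k + 1)).boundary.mass := by
  have hK : IsCompact (closedBall a (r * ρ)) := isCompact_closedBall _ _
  obtain ⟨W', θ', ξ', hd, hZeq, hW'K, -, -⟩ :=
    hZ'.exists_data_subset hK (support_boundary_vectorCurrent_restrict_subset hξ a _)
  have hint := hd.2.2.2.1
  have heq := boundary_blowUpCurrent_restrict_eq hξ a hr ρ hd.1 hint hZeq
  have hA : (fun y : V => a + r • y) '' ((⊤ : Opens V) : Set V) ⊆ ((⊤ : Opens V) : Set V) := by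
    simp
  have hd' := hd.preimage_add_smul a hr hA
  have hsub : (fun y : V => a + r • y) ⁻¹' W' ∩ ((⊤ : Opens V) : Set V) ⊆ closedBall 0 ρ := by
    rintro y ⟨hy, -⟩
    have h := hW'K hy
    rw [mem_closedBall, dist_eq_norm, add_sub_cancel_left, norm_smul, Real.norm_of_nonneg hr.le] at h
    rw [mem_closedBall, dist_zero_right]
    exact le_of_mul_le_mul_left h hr
  refine ⟨Current.isRectifiable_of_eq_currentOfIntegration (isCompact_closedBall 0 ρ) hsub hd' heq,
    ?_⟩
  rw [heq, hZeq]
  exact mass_currentOfIntegration_preimage_add_smul_le hd.1 θ' ξ' a hr hA hint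

end Pieces

/-! ### Almost-everywhere bookkeeping along the scales -/

section AE

/-- If `P` holds for a.e. real `r`, then `P(c ρ)` holds for a.e. `ρ` (`c ≠ 0`): Lebesgue measure
is quasi-invariant under `ρ ↦ c ρ`. [cite: Federer1969, 2.7.16 (1)] -/
theorem ae_comp_mul_left_of_ae {P : ℝ → Prop} (h : ∀ᵐ r : ℝ, P r) {c : ℝ} (hc : c ≠ 0) :
    ∀ᵐ ρ : ℝ, P (c * ρ) := by
  rw [ae_iff] at h ⊢
  have : {ρ : ℝ | ¬P (c * ρ)} = (fun ρ => c * ρ) ⁻¹' {r | ¬P r} := rfl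
  rw [this, Real.volume_preimage_mul_left hc, h, mul_zero]

/-- **Fatou selection along the scales** ([White1989, p. 211]): for a monotone `f ≥ 0` with
`f(s) ≤ K s^{k+1}` (`s > 0`) and scales `λ_l > 0`, the rescaled functions
`f_l(t) = λ_l^{-(k+1)} f(λ_l t)` satisfy `∫_0^R f_l' ≤ f_l(R) ≤ K R^{k+1}`, hence
`liminf_l f_l'(ρ) < ∞` for a.e. `ρ > 0`. [cite: White1989, p. 211; Federer1969, 2.9.19] -/
theorem ae_liminf_ofReal_deriv_lt_top {f : ℝ → ℝ} (hf : Monotone f) (hf0 : ∀ s, 0 ≤ f s) {K : ℝ}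
    (hgrowth : ∀ s, 0 < s → f s ≤ K * s ^ (k + 1)) {lam : ℕ → ℝ} (hlam : ∀ l, 0 < lam l) :
    ∀ᵐ ρ : ℝ, 0 < ρ → liminf (fun l => ENNReal.ofReal
      (deriv (fun t => (lam l)⁻¹ ^ (k + 1) * f (lam l * t)) ρ)) atTop < ⊤ := by
  set F : ℕ → ℝ → ℝ≥0∞ := fun l ρ => ENNReal.ofReal
    (deriv (fun t => (lam l)⁻¹ ^ (k + 1) * f (lam l * t)) ρ) with hF
  have hFm : ∀ l, Measurable (F l) := fun l => ENNReal.measurable_ofReal.comp (measurable_deriv _)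
  have hlampow : ∀ l n, (0 : ℝ) ≤ (lam l)⁻¹ ^ n := fun l n => pow_nonneg (inv_nonneg.2 (hlam l).le) n
  have hmono : ∀ l, Monotone (fun t => (lam l)⁻¹ ^ (k + 1) * f (lam l * t)) := fun l s t hst =>
    mul_le_mul_of_nonneg_left (hf (mul_le_mul_of_nonneg_left hst (hlam l).le)) (hlampow l _)
  -- on each `(0, R)`
  have hR : ∀ R : ℕ, ∀ᵐ ρ ∂(volume.restrict (Ioo (0 : ℝ) ((R : ℝ) + 1))),
      liminf (fun l => F l ρ) atTop < ⊤ := by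
    intro R
    have hR' : (0 : ℝ) < (R : ℝ) + 1 := by positivity
    refine ae_lt_top (Measurable.liminf hFm) (ne_top_of_le_ne_top
      (ENNReal.ofReal_ne_top (r := K * ((R : ℝ) + 1) ^ (k + 1)))
      ((lintegral_liminf_le hFm).trans ?_) : _)
    refine liminf_le_of_frequently_le' (Frequently.of_forall fun l => ?_)
    calc ∫⁻ ρ in Ioo (0 : ℝ) ((R : ℝ) + 1), F l ρ
        ≤ ENNReal.ofReal ((lam l)⁻¹ ^ (k + 1) * f (lam l * ((R : ℝ) + 1)) -
            (lam l)⁻¹ ^ (k + 1) * f (lam l * 0)) :=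
          Monotone.lintegral_deriv_le (hmono l) 0 ((R : ℝ) + 1)
      _ ≤ ENNReal.ofReal (K * ((R : ℝ) + 1) ^ (k + 1)) := by
          refine ENNReal.ofReal_le_ofReal ?_
          have h0 : 0 ≤ (lam l)⁻¹ ^ (k + 1) * f (lam l * 0) :=
            mul_nonneg (hlampow l _) (hf0 _)
          have h1 : f (lam l * ((R : ℝ) + 1)) ≤ K * (lam l * ((R : ℝ) + 1)) ^ (k + 1) :=
            hgrowth _ (mul_pos (hlam l) hR')
          have h2 : (lam l)⁻¹ ^ (k + 1) * f (lam l * ((R : ℝ) + 1)) ≤ K * ((R : ℝ) + 1) ^ (k + 1) := by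
            calc (lam l)⁻¹ ^ (k + 1) * f (lam l * ((R : ℝ) + 1))
                ≤ (lam l)⁻¹ ^ (k + 1) * (K * (lam l * ((R : ℝ) + 1)) ^ (k + 1)) :=
                  mul_le_mul_of_nonneg_left h1 (hlampow l _)
              _ = K * ((R : ℝ) + 1) ^ (k + 1) := by
                  rw [mul_pow, ← mul_assoc, ← mul_assoc, mul_comm ((lam l)⁻¹ ^ (k + 1)) K,
                    mul_assoc K, ← mul_pow, inv_mul_cancel₀ (hlam l).ne', one_pow, mul_one]
          linarith
  -- all `R`
  have hall : ∀ᵐ ρ : ℝ, ∀ R : ℕ, ρ ∈ Ioo (0 : ℝ) ((R : ℝ) + 1) →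
      liminf (fun l => F l ρ) atTop < ⊤ :=
    ae_all_iff.2 fun R => (ae_restrict_iff' measurableSet_Ioo).1 (hR R)
  filter_upwards [hall] with ρ hρ hρ0
  obtain ⟨R, hR⟩ := exists_nat_gt ρ
  exact hρ R ⟨hρ0, hR.trans (lt_add_one _)⟩

end AE

/-! ### The slices of the blow-up limit -/

section Main

variable {σ : Measure V} {ξ : V → Multivector V (k + 1)} {a : V} {lam : ℕ → ℝ} {ν : Measure V}

/-- **Almost every sphere slice of the cone limit is rectifiable** ([White1989, Step 5]): let
`T = σ ∧ ξ` be a cycle (`σ` finite, `ξ ∈ L¹`) whose ball pieces `T ⌞ 𝐁(a, r)` have rectifiable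
boundary for a.e. `r > 0`, with growth `‖T‖(𝐁(a, s)) ≤ K s^{k+1}`; let `a` be a normalised
Lebesgue point of `ξ`, `λ_l ↓ 0` with `σ_{a,λ_l} → ν` vaguely and `ν` charging no sphere about `0`.
Assume the induction hypothesis: weak limits of rectifiable boundaries of `(k+1)`-currents with
bounded mass and support in a fixed compact set are rectifiable. Then for a.e. `ρ > 0` the boundary
of the ball piece `(ν ⌞ 𝐁(0, ρ)) ∧ ξ(a)` of the cone limit is rectifiable: it is the weak limit of
the rectifiable boundaries `∂(T_{a,λ_l} ⌞ 𝐁(0, ρ))`, dilated slice boundaries of `T`, whose masses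
`≤ λ_l^{-k} C_k f'(λ_l ρ)` (`f = ‖T‖(𝐁(a, ·))`) stay bounded along a subsequence by Fatou's lemma.
[cite: White1989, pp. 211, 220; Bandara2006, proof of Thm. 4.2.1, p. 45] -/
theorem ae_isRectifiable_boundary_blowUpLimit_piece [IsFiniteMeasure σ] [IsLocallyFiniteMeasure ν]
    (IH : ∀ (K' : Set V), IsCompact K' → ∀ (c' : ℝ≥0∞), c' ≠ ⊤ →
      ∀ (Q : ℕ → Current (⊤ : Opens V) (k + 1)) (Z' : Current (⊤ : Opens V) k),
        (∀ i, (Q i).boundary.IsRectifiable ∧ (Q i).boundary.support ⊆ K' ∧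
          (Q i).boundary.mass ≤ c') →
        (∀ φ, Tendsto (fun i => (Q i).boundary φ) atTop (𝓝 (Z' φ))) → Z'.IsRectifiable)
    (hξ : Integrable ξ σ)
    (hT : (vectorCurrent σ ξ : Current (⊤ : Opens V) (k + 1)).boundary = 0)
    (hslices : ∀ᵐ r : ℝ, 0 < r →
      (vectorCurrent (σ.restrict (closedBall a r)) ξ :
        Current (⊤ : Opens V) (k + 1)).boundary.IsRectifiable)
    {K : ℝ} (hgrowth : ∀ s, 0 < s →
      ((vectorCurrent σ ξ : Current (⊤ : Opens V) (k + 1)).variation (closedBall a s)).toReal ≤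
        K * s ^ (k + 1))
    (hlam : ∀ l, 0 < lam l) (hlam0 : Tendsto lam atTop (𝓝 0))
    (hv : Measure.VagueTendsto (fun l => Measure.blowUp σ (k + 1) a (lam l)) ν)
    (hLeb : Tendsto (fun r => (r⁻¹) ^ (k + 1) * ∫ x in closedBall a r, ‖ξ x - ξ a‖ ∂σ)
      (𝓝[>] 0) (𝓝 0))
    (hν : ∀ ρ, ν (sphere 0 ρ) = 0) :
    ∀ᵐ ρ : ℝ, 0 < ρ →
      ((vectorCurrent (ν.restrict (closedBall 0 ρ)) (fun _ => ξ a) :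
        Current (⊤ : Opens V) (k + 1)).boundary).IsRectifiable := by
  classical
  set T : Current (⊤ : Opens V) (k + 1) := vectorCurrent σ ξ with hTdef
  have hloc : LocallyIntegrableOn ξ ((⊤ : Opens V) : Set V) σ :=
    hξ.locallyIntegrable.locallyIntegrableOn _
  have hTm : T.mass ≠ ⊤ := by
    rw [hTdef, mass_vectorCurrent_eq_lintegral hloc]
    exact hξ.2.ne
  -- the mass function of balls and the slice mass inequality
  set f : ℝ → ℝ := fun s => (T.variation (closedBall a s)).toReal with hf
  haveI : IsFiniteMeasure T.variation := T.isFiniteMeasure_variation hTm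
  have hfmono : Monotone f := fun s t hst =>
    ENNReal.toReal_mono (measure_ne_top _ _) (measure_mono (closedBall_subset_closedBall hst))
  have hf0 : ∀ s, 0 ≤ f s := fun s => ENNReal.toReal_nonneg
  have hsliceMass : ∀ᵐ r : ℝ, 0 < r → DifferentiableAt ℝ f r ∧
      (vectorCurrent (σ.restrict (closedBall a r)) ξ :
        Current (⊤ : Opens V) (k + 1)).boundary.mass ≤
        ENNReal.ofReal (sliceConst k * deriv f r) := by
    filter_upwards [T.ae_mass_boundary_piece_le_deriv hTm hT a] with r hr hr0
    obtain ⟨hd, hm⟩ := hr hr0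
    refine ⟨hd, ?_⟩
    have hrs : (T.isRepresentable_of_mass_ne_top hTm).restrictSet (closedBall a r)
        measurableSet_closedBall =
        (vectorCurrent (σ.restrict (closedBall a r)) ξ : Current (⊤ : Opens V) (k + 1)) :=
      restrictSet_vectorCurrent hloc measurableSet_closedBall
    rw [← hrs]
    exact hm
  -- good radii, transported along every scale `λ_l`
  have hgood : ∀ᵐ ρ : ℝ, ∀ l, 0 < lam l * ρ →
      (vectorCurrent (σ.restrict (closedBall a (lam l * ρ))) ξ :
          Current (⊤ : Opens V) (k + 1)).boundary.IsRectifiable ∧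
        DifferentiableAt ℝ f (lam l * ρ) ∧
        (vectorCurrent (σ.restrict (closedBall a (lam l * ρ))) ξ :
          Current (⊤ : Opens V) (k + 1)).boundary.mass ≤
          ENNReal.ofReal (sliceConst k * deriv f (lam l * ρ)) :=
    ae_all_iff.2 fun l => ae_comp_mul_left_of_ae
      (P := fun r => 0 < r → (vectorCurrent (σ.restrict (closedBall a r)) ξ :
          Current (⊤ : Opens V) (k + 1)).boundary.IsRectifiable ∧ DifferentiableAt ℝ f r ∧
        (vectorCurrent (σ.restrict (closedBall a r)) ξ :
          Current (⊤ : Opens V) (k + 1)).boundary.mass ≤ ENNReal.ofReal (sliceConst k * deriv f r))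
      (by filter_upwards [hslices, hsliceMass] with r h1 h2 hr0; exact ⟨h1 hr0, h2 hr0⟩)
      (hlam l).ne'
  -- Fatou selection
  have hFatou := ae_liminf_ofReal_deriv_lt_top (k := k) hfmono hf0 hgrowth hlam
  filter_upwards [hgood, hFatou] with ρ hgoodρ hFatouρ hρ0
  -- the ball pieces of the blow-ups and their boundaries
  set Q : ℕ → Current (⊤ : Opens V) (k + 1) := fun l =>
    vectorCurrent ((Measure.blowUp σ (k + 1) a (lam l)).restrict (closedBall 0 ρ))
      (fun y => ξ (a + lam l • y)) with hQ
  have hQrect : ∀ l, (Q l).boundary.IsRectifiable ∧ (Q l).boundary.mass ≤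
      ENNReal.ofReal ((lam l)⁻¹ ^ k) * (vectorCurrent (σ.restrict (closedBall a (lam l * ρ))) ξ :
        Current (⊤ : Opens V) (k + 1)).boundary.mass := fun l =>
    isRectifiable_boundary_blowUpCurrent_restrict hξ a (hlam l) ρ
      (hgoodρ l (mul_pos (hlam l) hρ0)).1
  have hQsupp : ∀ l, (Q l).boundary.support ⊆ closedBall 0 ρ := by
    intro l
    have := support_boundary_vectorCurrent_restrict_subset (k := k)
      (σ := Measure.blowUp σ (k + 1) a (lam l)) (ξ := fun y => ξ (a + lam l • y))
      (integrable_comp_blowUp hξ a (hlam l)) 0 ρ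
    exact this
  -- masses along the scales: `𝐌(∂Q_l) ≤ C_k F_l(ρ)` with `F_l(ρ) = λ_l^{-k} f'(λ_l ρ)`
  set F : ℕ → ℝ≥0∞ := fun l => ENNReal.ofReal
    (deriv (fun t => (lam l)⁻¹ ^ (k + 1) * f (lam l * t)) ρ) with hFdef
  have hderiv : ∀ l, deriv (fun t => (lam l)⁻¹ ^ (k + 1) * f (lam l * t)) ρ =
      (lam l)⁻¹ ^ k * deriv f (lam l * ρ) := by
    intro l
    have hd : DifferentiableAt ℝ f (lam l * ρ) := (hgoodρ l (mul_pos (hlam l) hρ0)).2.1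
    have h1 : HasDerivAt (fun t => lam l * t) (lam l) ρ := by
      simpa using (hasDerivAt_id ρ).const_mul (lam l)
    have h2 : HasDerivAt (fun t => f (lam l * t)) (deriv f (lam l * ρ) * lam l) ρ :=
      hd.hasDerivAt.comp ρ h1
    have h3 := h2.const_mul ((lam l)⁻¹ ^ (k + 1))
    rw [h3.deriv]
    calc (lam l)⁻¹ ^ (k + 1) * (deriv f (lam l * ρ) * lam l)
        = (lam l)⁻¹ ^ k * deriv f (lam l * ρ) * ((lam l)⁻¹ * lam l) := by ring
      _ = (lam l)⁻¹ ^ k * deriv f (lam l * ρ) := by rw [inv_mul_cancel₀ (hlam l).ne', mul_one]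
  have hmassF : ∀ l, (Q l).boundary.mass ≤ ENNReal.ofReal (sliceConst k) * F l := by
    intro l
    obtain ⟨-, -, hm⟩ := hgoodρ l (mul_pos (hlam l) hρ0)
    calc (Q l).boundary.mass
        ≤ ENNReal.ofReal ((lam l)⁻¹ ^ k) * (vectorCurrent (σ.restrict (closedBall a (lam l * ρ))) ξ :
            Current (⊤ : Opens V) (k + 1)).boundary.mass := (hQrect l).2
      _ ≤ ENNReal.ofReal ((lam l)⁻¹ ^ k) * ENNReal.ofReal (sliceConst k * deriv f (lam l * ρ)) := by
          gcongr
      _ = ENNReal.ofReal (sliceConst k) * F l := by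
          rw [hFdef]
          dsimp only
          rw [hderiv l, ← ENNReal.ofReal_mul (pow_nonneg (inv_nonneg.2 (hlam l).le) k),
            ← ENNReal.ofReal_mul (sliceConst_nonneg k)]
          congr 1
          ring
  -- a subsequence with bounded boundary masses
  replace hFatouρ := hFatouρ hρ0
  have hfreq : ∃ᶠ l in atTop, F l < liminf F atTop + 1 :=
    frequently_lt_of_liminf_lt (by isBoundedDefault) (ENNReal.lt_add_right hFatouρ.ne one_ne_zero)
  obtain ⟨ι, hι, hιF⟩ := extraction_of_frequently_atTop hfreq
  set c' : ℝ≥0∞ := ENNReal.ofReal (sliceConst k) * (liminf F atTop + 1) with hc'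
  have hc'top : c' ≠ ⊤ :=
    ENNReal.mul_ne_top ENNReal.ofReal_ne_top (ENNReal.add_ne_top.2 ⟨hFatouρ.ne, ENNReal.one_ne_top⟩)
  -- convergence of the ball pieces to the ball piece of the cone limit
  set C : Current (⊤ : Opens V) (k + 1) :=
    vectorCurrent (ν.restrict (closedBall 0 ρ)) (fun _ => ξ a) with hC
  have hfront : ν (frontier (closedBall (0 : V) ρ)) = 0 :=
    measure_mono_null frontier_closedBall_subset_sphere (hν ρ)
  have hconv : ∀ φ : TestForm (⊤ : Opens V) k,
      Tendsto (fun j => (Q (ι j)).boundary φ) atTop (𝓝 (C.boundary φ)) := by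
    intro φ
    simp only [Current.boundary_apply]
    exact (tendsto_blowUpCurrent_restrict_apply hξ hlam hlam0 hv hLeb measurableSet_closedBall
      hfront (TestForm.extDerivCLM φ)).comp hι.tendsto_atTop
  refine IH (closedBall 0 ρ) (isCompact_closedBall 0 ρ) c' hc'top (fun j => Q (ι j)) C.boundary
    (fun j => ⟨(hQrect (ι j)).1, hQsupp (ι j), (hmassF (ι j)).trans ?_⟩) hconv
  rw [hc']
  gcongr
  exact (hιF j).le

end Main

end Literature.Geometry.GeometricMeasureTheory
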